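import Literature.NumberTheory.Automorphic.UnitaryGroupArthurKernelClassExpansion
import Literature.NumberTheory.Automorphic.UnitaryGroupUnipotentHaarTorusConj
import HarnessLib

/-!
# The class Borel kernel `K_{B,𝔬}` of `U(J_N)` fibres over the class cell of the rational torus, and on
# `U(3)` it is `δ_B`-homogeneous: `K_{B,𝔬}(b x, b y) = δ_B(b) K_{B,𝔬}(x, y)`
(Rogawski, *Automorphic Representations of Unitary Groups in Three Variables* (1990), §2.2, p. 13:
`K_{P,𝔬}(x, y) = Σ_{γ ∈ M_P ∩ 𝔬̲′} ∫_{𝐍_P} f(x⁻¹ γ n y) dn` for `P = B`, `M_P = T`; Arthur, Duke Math. J. 45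
(1978), §7, where the truncated kernel is estimated CLASS BY CLASS)

Topic `NumberTheory/Automorphic`; namespace `Literature.NumberTheory.Automorphic.UnitaryGroup`. THEOREMS
ONLY over accepted tree modules: no definition, no named fact, no `sorry`, no instance, no notation.

Setting: the quasi-split unitary group `G = U(J_N)` (★ `quasiSplit F E c N`), `N(𝔸_F) =` ★ `adelicUnipotent`,
`B(F) =` ★ `arithmeticBorel`, `T(F) =` ★ `rationalTorus`, `N(F) =` ★ `rationalUnipotent`, an ABSTRACT class
map `cl : G(F) → ι` with Rogawski's partition axiom ★ `IsUnipotentInvariantOnBorel F E c N cl`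
(`cl (β n) = cl β` for `β ∈ B(F)`, `n ∈ N(F)`: an element of `B(F)` lies in the class of its
`T(F)`-component), and the class Borel kernel ★ `kernelBorelClass ν 𝓕 cl 𝔬 f x y =
ν(𝓕)⁻¹ ∫_𝓕 Σ_{β ∈ B(F), cl β = 𝔬} f(x⁻¹ β u y) dν(u)` of ★ `UnitaryGroupArthurKernelClassExpansion`.
This file is the per-`𝔬` replay of ★ `UnitaryGroupKernelBorelTorusFibration` §2 and of
★ `UnitaryGroupUnipotentHaarTorusConj` §3, with the sum over `B(F)` cut to ONE class:

* §1 `exists_equiv_borelClassCell_prod` — **the class cell of `B(F)` over `𝔬` is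
  `(T(F) ∩ 𝔬̲) × N(F)`**: the rational Levi decomposition `B(F) ≃ T(F) × N(F)`, `β = t n`
  (★ `exists_equiv_arithmeticBorel_prod`) restricts to `{β ∈ B(F) | cl β = 𝔬} ≃ {t ∈ T(F) | cl t = 𝔬} × N(F)`
  because `cl (t n) = cl t` (`IsUnipotentInvariantOnBorel`).
* §2 (every `N`) **`kernelBorelClass_eq_smul_tsum_integral`** — Rogawski's printed formula for `K_{B,𝔬}`:
  for `f ∈ C_c(G(𝔸_F))`, every Haar measure `ν` of `N(𝔸_F)`, every fundamental domain `𝓕` of `N(F)` and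
  all `x, y`: `K_{B,𝔬}(x, y) = ν(𝓕)⁻¹ · Σ_{t ∈ T(F), cl t = 𝔬} ∫_{N(𝔸_F)} f(x⁻¹ t m y) dν(m)` (§1, then the
  unfolding `∫_𝓕 Σ_{n ∈ N(F)} = ∫_{N(𝔸_F)}` fibre by fibre, ★ `setIntegral_tsum_prod_smul_eq_tsum_integral`;
  only finitely many fibres are live, ★ `finite_setOf_rationalTorus_meets_support`).
* §3 (`N = 3`, `c` the non-trivial involution: `hc : c * c = 1`, `hc1 : c ≠ 1`)
  **`kernelBorelClass_borel_mul_mul`** — `K_{B,𝔬}(b x, b y) = δ_B(b) · K_{B,𝔬}(x, y)` for every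
  `b ∈ B(𝔸_F)`, `δ_B(b) = torusRootModulus E 3 (diagUnit b)`: fibre by fibre
  `(bx)⁻¹ t m (by) = x⁻¹ · t [t, b] (b⁻¹ m b) · y` with `[t, b] = t⁻¹ b⁻¹ t b ∈ N(𝔸_F)`
  (★ `torus_commutator_mem_adelicUnipotent`), and `∫ φ(b⁻¹ m b) dν(m) = δ_B(b) ∫ φ dν`
  (★ `integral_comp_borelConj`) — the `δ_B`-homogeneity input of the per-class polynomial identity for
  the truncated trace `J^T_𝔬(f)` (the growth `K_{B,𝔬}(g, g) ≍ H(g)²` in the cusp). For `b ∈ B(F)` on the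
  diagonal this is the `B(F)`-invariance ★ `kernelBorelClass_diag_rational_borel_mul` (`δ_B(b) = 1`).

## References

* J. D. Rogawski, *Automorphic Representations of Unitary Groups in Three Variables*, Annals of
  Mathematics Studies 123 (1990), §1.10, §2.1 (p. 11), §2.2 (p. 13) [Rogawski1990].
* P. Garrett, *Modern Analysis of Automorphic Forms by Example* (2018), §2.3, §2.10 [Garrett2018].
* J. Arthur, *A trace formula for reductive groups I*, Duke Math. J. 45 (1978), §7 — cited through the
  held expositions above.
-/

set_option autoImplicit false

noncomputable section

open MeasureTheory NumberField IsDedekindDomain Topology Set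
open scoped NNReal ENNReal MatrixGroups

namespace Literature.NumberTheory.Automorphic

namespace UnitaryGroup

variable {F E : Type} [Field F] [NumberField F] [Field E] [NumberField E] [Algebra F E]
  {c : E ≃ₐ[F] E} {N : ℕ} {ι : Type*}

/-! ## §1 The class cell of `B(F)` over `𝔬` is `(T(F) ∩ 𝔬̲) × N(F)` -/

/-- **The class cell of the rational Borel fibres over the class cell of the rational torus**: under
`IsUnipotentInvariantOnBorel` (`cl (β n) = cl β` on `B(F)`), the rational Levi decomposition
`B(F) ≃ T(F) × N(F)`, `β = t n` (★ `exists_equiv_arithmeticBorel_prod`) restricts to an equivalence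
`{β ∈ B(F) | cl β = 𝔬} ≃ {t ∈ T(F) | cl t = 𝔬} × N(F)` with `e⁻¹ (t, n) = t n` — the class of `β = t n` is the
class of its `T(F)`-component (Rogawski (1990), §2.2: `K_{P,𝔬}` sums over `M_P ∩ 𝔬̲′` and integrates over
the full `𝐍_P`). [cite: Rogawski1990, §2.2 (p. 13)] -/
theorem exists_equiv_borelClassCell_prod {cl : (quasiSplit F E c N).arithmeticSubgroup → ι}
    (hclN : IsUnipotentInvariantOnBorel F E c N cl) (i : ι) :
    ∃ e : ((fun β : arithmeticBorel F E c N => cl β) ⁻¹' {i}) ≃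
        {t : rationalTorus F E c N //
            cl ⟨((t : torusAdelic F E c N) : (quasiSplit F E c N).Adelic), t.2⟩ = i} ×
          rationalUnipotent F E c N,
      ∀ p, ((((e.symm p : (fun β : arithmeticBorel F E c N => cl β) ⁻¹' {i}) :
          arithmeticBorel F E c N) : (quasiSplit F E c N).arithmeticSubgroup) :
            (quasiSplit F E c N).Adelic) =
        ((p.1.1 : torusAdelic F E c N) : (quasiSplit F E c N).Adelic) *
          ((p.2 : adelicUnipotent F E c N) : (quasiSplit F E c N).Adelic) := by
  obtain ⟨e, he⟩ := exists_equiv_arithmeticBorel_prod (F := F) (E := E) (c := c) (N := N)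
  -- the class of `β = t n` is the class of `t`
  have hcl : ∀ p : rationalTorus F E c N × rationalUnipotent F E c N,
      cl ((e.symm p : arithmeticBorel F E c N) : (quasiSplit F E c N).arithmeticSubgroup) =
        cl ⟨((p.1 : torusAdelic F E c N) : (quasiSplit F E c N).Adelic), p.1.2⟩ := by
    intro p
    have hprod : ((e.symm p : arithmeticBorel F E c N) : (quasiSplit F E c N).arithmeticSubgroup) =
        (⟨((p.1 : torusAdelic F E c N) : (quasiSplit F E c N).Adelic), p.1.2⟩ :
            (quasiSplit F E c N).arithmeticSubgroup) *
          ⟨((p.2 : adelicUnipotent F E c N) : (quasiSplit F E c N).Adelic), p.2.2⟩ :=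
      Subtype.ext (he p)
    rw [hprod]
    exact hclN _ _ ((mem_arithmeticBorel_iff _).2 (torusAdelic_le_borelAdelic p.1.1.2)) p.2.1.2
  refine ⟨⟨fun β => (⟨(e (β : arithmeticBorel F E c N)).1, ?_⟩, (e (β : arithmeticBorel F E c N)).2),
    fun p => ⟨e.symm ((p.1 : rationalTorus F E c N), p.2), ?_⟩, fun β => ?_, fun p => ?_⟩,
    fun p => he ((p.1 : rationalTorus F E c N), p.2)⟩
  · -- `cl t = cl β = 𝔬` for `β = t n`
    have h := hcl (e (β : arithmeticBorel F E c N))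
    rw [Equiv.symm_apply_apply] at h
    have hβ : cl ((β : arithmeticBorel F E c N) : (quasiSplit F E c N).arithmeticSubgroup) = i := β.2
    exact h.symm.trans hβ
  · -- `cl (t n) = cl t = 𝔬`
    change cl ((e.symm ((p.1 : rationalTorus F E c N), p.2) : arithmeticBorel F E c N) :
        (quasiSplit F E c N).arithmeticSubgroup) = i
    exact (hcl ((p.1 : rationalTorus F E c N), p.2)).trans p.1.2
  · exact Subtype.ext (by simp only [Prod.mk.eta, Equiv.symm_apply_apply])
  · exact Prod.ext (Subtype.ext (by simp only [Equiv.apply_symm_apply]))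
      (by simp only [Equiv.apply_symm_apply])

/-! ## §2 `K_{B,𝔬}(x, y) = ν(𝓕)⁻¹ Σ_{t ∈ T(F), cl t = 𝔬} ∫_{N(𝔸_F)} f(x⁻¹ t m y) dν(m)` -/

/-- `N(F)` and `T(F)` are countable (they inject into the countable `G(F)`; private plumbing, as in
★ `UnitaryGroupKernelBorelTorusFibration`). [folklore] -/
private theorem countable_rationalUnipotent_rationalTorus₈ :
    Countable (rationalUnipotent F E c N) ∧ Countable (rationalTorus F E c N) := by
  haveI : Countable (quasiSplit F E c N).arithmeticSubgroup := by
    haveI : Countable E := NumberField.countable' (K := E)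
    haveI : Countable (Matrix (Fin N) (Fin N) E) := inferInstanceAs (Countable (Fin N → Fin N → E))
    haveI : Countable (GL (Fin N) E) := Units.val_injective.countable
    haveI : Countable (quasiSplit F E c N).Rational :=
      inferInstanceAs (Countable (rational F E c N ((StdForm.antidiagonal N).over E)))
    exact (Set.countable_range _).to_subtype
  have h1 : Function.Injective fun γ : rationalUnipotent F E c N =>
      (⟨((γ : adelicUnipotent F E c N) : (quasiSplit F E c N).Adelic), γ.2⟩ :
        (quasiSplit F E c N).arithmeticSubgroup) := fun a a' h =>
    Subtype.ext (Subtype.ext (congrArg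
      (fun z : (quasiSplit F E c N).arithmeticSubgroup => (z : (quasiSplit F E c N).Adelic)) h))
  have h2 : Function.Injective fun t : rationalTorus F E c N =>
      (⟨((t : torusAdelic F E c N) : (quasiSplit F E c N).Adelic), t.2⟩ :
        (quasiSplit F E c N).arithmeticSubgroup) := fun a a' h =>
    Subtype.ext (Subtype.ext (congrArg
      (fun z : (quasiSplit F E c N).arithmeticSubgroup => (z : (quasiSplit F E c N).Adelic)) h))
  exact ⟨h1.countable, h2.countable⟩

section KernelBorelClass

variable [MeasurableSpace (adelicUnipotent F E c N)] [BorelSpace (adelicUnipotent F E c N)]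

/-- **Rogawski's formula for the class Borel kernel** (`U(J_N)`, every `N`): for `f ∈ C_c(G(𝔸_F))`, a Haar
measure `ν` of `N(𝔸_F)`, a fundamental domain `𝓕` of `N(F)` in `N(𝔸_F)`, a class map constant along `N(F)`
on `B(F)` and all `x, y ∈ G(𝔸_F)`:
`K_{B,𝔬}(x, y) = ν(𝓕)⁻¹ · Σ_{t ∈ T(F), cl t = 𝔬} ∫_{N(𝔸_F)} f(x⁻¹ t m y) dν(m)`
— the tree's ★ `kernelBorelClass ν 𝓕 cl 𝔬 f x y = ν(𝓕)⁻¹ ∫_𝓕 Σ_{β ∈ B(F), cl β = 𝔬} f(x⁻¹ β u y) dν(u)` IS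
the printed `K_{P,𝔬}(x, y) = Σ_{γ ∈ M_P ∩ 𝔬̲′} ∫_{𝐍_P} f(x⁻¹ γ n y) dn` (`P = B`, Tamagawa `dn`). Proof: the
class cell is `(T(F) ∩ 𝔬̲) × N(F)` (§1), then unfold `∫_𝓕 Σ_{n ∈ N(F)} = ∫_{N(𝔸_F)}` fibre by fibre
(★ `setIntegral_tsum_prod_smul_eq_tsum_integral`); only finitely many fibres are non-zero
(★ `finite_setOf_rationalTorus_meets_support`). [cite: Rogawski1990, §2.2 (p. 13)] -/
theorem kernelBorelClass_eq_smul_tsum_integral {cl : (quasiSplit F E c N).arithmeticSubgroup → ι}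
    (ν : Measure (adelicUnipotent F E c N)) [ν.IsHaarMeasure]
    {𝓕 : Set (adelicUnipotent F E c N)} (h𝓕 : IsFundamentalDomain (rationalUnipotent F E c N) 𝓕 ν)
    (hclN : IsUnipotentInvariantOnBorel F E c N cl)
    {f : (quasiSplit F E c N).Adelic → ℂ} (hfc : Continuous f) (hf : HasCompactSupport f)
    (x y : (quasiSplit F E c N).Adelic) (i : ι) :
    kernelBorelClass ν 𝓕 cl i f x y = ((ν 𝓕).toReal⁻¹ : ℝ) •
      ∑' t : {t : rationalTorus F E c N //
          cl ⟨((t : torusAdelic F E c N) : (quasiSplit F E c N).Adelic), t.2⟩ = i},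
        ∫ m : adelicUnipotent F E c N,
          f (x⁻¹ * (((t : rationalTorus F E c N) : torusAdelic F E c N) : (quasiSplit F E c N).Adelic) *
            ((m : adelicUnipotent F E c N) : (quasiSplit F E c N).Adelic) * y) ∂ν := by
  obtain ⟨hcN, hcT⟩ := countable_rationalUnipotent_rationalTorus₈ (F := F) (E := E) (c := c) (N := N)
  haveI := hcN
  haveI := hcT
  haveI : MeasurableConstSMul (rationalUnipotent F E c N) (adelicUnipotent F E c N) :=
    ⟨fun γ => (continuous_const.mul continuous_id).measurable⟩
  haveI : SMulInvariantMeasure (rationalUnipotent F E c N) (adelicUnipotent F E c N) ν :=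
    ⟨fun γ s _hs => by
      rw [show (fun u : adelicUnipotent F E c N => γ • u) ⁻¹' s =
          (fun u : adelicUnipotent F E c N => ((γ : adelicUnipotent F E c N)) * u) ⁻¹' s from rfl,
        measure_preimage_mul]⟩
  -- the fibre integrands `φ_t(m) = f(x⁻¹ t m y)` on the class cell of `T(F)`
  set φ : {t : rationalTorus F E c N //
      cl ⟨((t : torusAdelic F E c N) : (quasiSplit F E c N).Adelic), t.2⟩ = i} →
        adelicUnipotent F E c N → ℂ := fun t m =>
    f (x⁻¹ * (((t : rationalTorus F E c N) : torusAdelic F E c N) : (quasiSplit F E c N).Adelic) *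
      ((m : adelicUnipotent F E c N) : (quasiSplit F E c N).Adelic) * y) with hφ
  have hφc : ∀ t, Continuous (φ t) := fun t =>
    hfc.comp ((continuous_const.mul continuous_subtype_val).mul continuous_const)
  have hφi : ∀ t, Integrable (φ t) ν := fun t =>
    (hφc t).integrable_of_hasCompactSupport (hasCompactSupport_comp_mul_adelicUnipotent_mul hf _ _)
  -- pointwise fibration of the class Borel sum over `(T(F) ∩ 𝔬̲) × N(F)` (§1)
  obtain ⟨e, he⟩ := exists_equiv_borelClassCell_prod hclN i
  have hpt : ∀ u : adelicUnipotent F E c N,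
      borelSumClass cl i f x (((u : adelicUnipotent F E c N) : (quasiSplit F E c N).Adelic) * y) =
        ∑' p : {t : rationalTorus F E c N //
            cl ⟨((t : torusAdelic F E c N) : (quasiSplit F E c N).Adelic), t.2⟩ = i} ×
              rationalUnipotent F E c N, φ p.1 (p.2 • u) := by
    intro u
    rw [borelSumClass_def, ← e.symm.tsum_eq]
    refine tsum_congr fun p => ?_
    rw [he p]
    simp only [hφ, Subgroup.smul_def, smul_eq_mul, Subgroup.coe_mul, mul_assoc]
  -- only finitely many fibres are non-zero, so the total `L¹` mass is finite
  have hS : {t : {t : rationalTorus F E c N //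
      cl ⟨((t : torusAdelic F E c N) : (quasiSplit F E c N).Adelic), t.2⟩ = i} |
        ∃ m : adelicUnipotent F E c N, φ t m ≠ 0}.Finite := by
    have h0 := (finite_setOf_rationalTorus_meets_support hf x y).preimage
      (f := (Subtype.val : {t : rationalTorus F E c N //
        cl ⟨((t : torusAdelic F E c N) : (quasiSplit F E c N).Adelic), t.2⟩ = i} → rationalTorus F E c N))
      Subtype.val_injective.injOn
    exact h0.subset fun t ht => ht
  have hzero : ∀ t ∉ hS.toFinset, φ t = 0 := by
    intro t ht
    funext m
    by_contra h
    exact ht (hS.mem_toFinset.2 ⟨m, h⟩)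
  have hfin : ∑' t, ∫⁻ m, ‖φ t m‖ₑ ∂ν ≠ ⊤ := by
    rw [tsum_eq_sum (s := hS.toFinset) (fun t ht => by rw [hzero t ht]; simp)]
    exact ENNReal.sum_ne_top.2 fun t _ => (hφi t).2.ne
  rw [kernelBorelClass_def, borelConstantTerm_def]
  congr 1
  simp_rw [hpt]
  exact setIntegral_tsum_prod_smul_eq_tsum_integral h𝓕 hφi hfin

/-- The diagonal case: **`K_{B,𝔬}(g, g) = ν(𝓕)⁻¹ Σ_{t ∈ T(F), cl t = 𝔬} ∫_{N(𝔸_F)} f(g⁻¹ t m g) dν(m)`**.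
[cite: Rogawski1990, §2.2 (p. 13)] -/
theorem kernelBorelClass_diag_eq_smul_tsum_integral {cl : (quasiSplit F E c N).arithmeticSubgroup → ι}
    (ν : Measure (adelicUnipotent F E c N)) [ν.IsHaarMeasure]
    {𝓕 : Set (adelicUnipotent F E c N)} (h𝓕 : IsFundamentalDomain (rationalUnipotent F E c N) 𝓕 ν)
    (hclN : IsUnipotentInvariantOnBorel F E c N cl)
    {f : (quasiSplit F E c N).Adelic → ℂ} (hfc : Continuous f) (hf : HasCompactSupport f)
    (g : (quasiSplit F E c N).Adelic) (i : ι) :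
    kernelBorelClass ν 𝓕 cl i f g g = ((ν 𝓕).toReal⁻¹ : ℝ) •
      ∑' t : {t : rationalTorus F E c N //
          cl ⟨((t : torusAdelic F E c N) : (quasiSplit F E c N).Adelic), t.2⟩ = i},
        ∫ m : adelicUnipotent F E c N,
          f (g⁻¹ * (((t : rationalTorus F E c N) : torusAdelic F E c N) : (quasiSplit F E c N).Adelic) *
            ((m : adelicUnipotent F E c N) : (quasiSplit F E c N).Adelic) * g) ∂ν :=
  kernelBorelClass_eq_smul_tsum_integral ν h𝓕 hclN hfc hf g g i

end KernelBorelClass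

/-! ## §3 `K_{B,𝔬}(b x, b y) = δ_B(b) K_{B,𝔬}(x, y)` on `U(3)` -/

section Homogeneity

variable [MeasurableSpace (adelicUnipotent F E c 3)] [BorelSpace (adelicUnipotent F E c 3)]

/-- **`K_{B,𝔬}(b x, b y) = δ_B(b) · K_{B,𝔬}(x, y)`** for every `b ∈ B(𝔸_F)`, all `x, y ∈ U(J₃)(𝔸_F)`,
`f ∈ C_c(U(J₃)(𝔸_F))`, every Haar measure `ν` of `N(𝔸_F)`, every fundamental domain `𝓕` of `N(F)` and every
class `𝔬` of a class map constant along `N(F)` on `B(F)` (`δ_B(b) = torusRootModulus E 3 (diagUnit b)`):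
by §2, `K_{B,𝔬}(x, y) = ν(𝓕)⁻¹ Σ_{t ∈ T(F), cl t = 𝔬} ∫ f(x⁻¹ t m y) dν(m)`, and for each `t`:
`(bx)⁻¹ t m (by) = x⁻¹ · t [t, b] (b⁻¹ m b) · y` with `[t, b] ∈ N(𝔸_F)` (★ `torus_commutator_mem_adelicUnipotent`),
so the fibre integral picks up exactly `δ_B(b)` (★ `integral_comp_borelConj` and left invariance of `ν`)
— the per-class replay of ★ `kernelBorel_borel_mul_mul`; along `T(𝔸_F)` it is the growth
`K_{B,𝔬}(g, g) ≍ H(g)²` in the cusp (Rogawski (1990), §2.2, `K_{P,𝔬}`). [cite: Rogawski1990, §2.2 (p. 13)] -/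
theorem kernelBorelClass_borel_mul_mul {cl : (quasiSplit F E c 3).arithmeticSubgroup → ι}
    (hc : c * c = 1) (hc1 : c ≠ 1)
    (ν : Measure (adelicUnipotent F E c 3)) [ν.IsHaarMeasure] {𝓕 : Set (adelicUnipotent F E c 3)}
    (h𝓕 : IsFundamentalDomain (rationalUnipotent F E c 3) 𝓕 ν)
    (hclN : IsUnipotentInvariantOnBorel F E c 3 cl)
    {f : (quasiSplit F E c 3).Adelic → ℂ} (hfc : Continuous f) (hf : HasCompactSupport f)
    (b : borelAdelic F E c 3) (x y : (quasiSplit F E c 3).Adelic) (i : ι) :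
    kernelBorelClass ν 𝓕 cl i f ((b : (quasiSplit F E c 3).Adelic) * x) ((b : (quasiSplit F E c 3).Adelic) * y) =
      (torusRootModulus E 3 (diagUnit b.2) : ℝ) • kernelBorelClass ν 𝓕 cl i f x y := by
  rw [kernelBorelClass_eq_smul_tsum_integral ν h𝓕 hclN hfc hf _ _ i,
    kernelBorelClass_eq_smul_tsum_integral ν h𝓕 hclN hfc hf x y i,
    smul_comm, ← tsum_const_smul'' (torusRootModulus E 3 (diagUnit b.2) : ℝ)]
  congr 1
  refine tsum_congr fun t => ?_
  -- the commutator `[t, b] ∈ N(𝔸_F)`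
  have hct := torus_commutator_mem_adelicUnipotent
    (((t : rationalTorus F E c 3) : torusAdelic F E c 3)).2 b
  -- rewrite the integrand: `(bx)⁻¹ t m (by) = x⁻¹ t ([t, b] (b⁻¹ m b)) y`
  have hpt : ∀ m : adelicUnipotent F E c 3,
      f (((b : (quasiSplit F E c 3).Adelic) * x)⁻¹ *
          (((t : rationalTorus F E c 3) : torusAdelic F E c 3) : (quasiSplit F E c 3).Adelic) *
          ((m : adelicUnipotent F E c 3) : (quasiSplit F E c 3).Adelic) * ((b : (quasiSplit F E c 3).Adelic) * y)) =
        (fun u : adelicUnipotent F E c 3 =>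
          f (x⁻¹ * (((t : rationalTorus F E c 3) : torusAdelic F E c 3) : (quasiSplit F E c 3).Adelic) *
            (((⟨_, hct⟩ : adelicUnipotent F E c 3) * u : adelicUnipotent F E c 3) :
              (quasiSplit F E c 3).Adelic) * y))
          ⟨(b : (quasiSplit F E c 3).Adelic)⁻¹ * (m : (quasiSplit F E c 3).Adelic) * (b : (quasiSplit F E c 3).Adelic),
            conj_mem_adelicUnipotent b.2 m.2⟩ := by
    intro m
    refine congrArg f ?_
    change ((b : (quasiSplit F E c 3).Adelic) * x)⁻¹ *
        (((t : rationalTorus F E c 3) : torusAdelic F E c 3) : (quasiSplit F E c 3).Adelic) *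
        ((m : adelicUnipotent F E c 3) : (quasiSplit F E c 3).Adelic) * ((b : (quasiSplit F E c 3).Adelic) * y) =
      x⁻¹ * (((t : rationalTorus F E c 3) : torusAdelic F E c 3) : (quasiSplit F E c 3).Adelic) *
        (((((t : rationalTorus F E c 3) : torusAdelic F E c 3) : (quasiSplit F E c 3).Adelic)⁻¹ *
            (b : (quasiSplit F E c 3).Adelic)⁻¹ *
            (((t : rationalTorus F E c 3) : torusAdelic F E c 3) : (quasiSplit F E c 3).Adelic) *
            (b : (quasiSplit F E c 3).Adelic)) *
          ((b : (quasiSplit F E c 3).Adelic)⁻¹ * (m : (quasiSplit F E c 3).Adelic) * (b : (quasiSplit F E c 3).Adelic))) * y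
    simp only [mul_inv_rev, mul_assoc, mul_inv_cancel_left]
  simp_rw [hpt]
  rw [integral_comp_borelConj hc hc1 ν b (fun u : adelicUnipotent F E c 3 =>
      f (x⁻¹ * (((t : rationalTorus F E c 3) : torusAdelic F E c 3) : (quasiSplit F E c 3).Adelic) *
        (((⟨_, hct⟩ : adelicUnipotent F E c 3) * u : adelicUnipotent F E c 3) : (quasiSplit F E c 3).Adelic) * y)),
    integral_mul_left_eq_self (fun u : adelicUnipotent F E c 3 =>
      f (x⁻¹ * (((t : rationalTorus F E c 3) : torusAdelic F E c 3) : (quasiSplit F E c 3).Adelic) *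
        ((u : adelicUnipotent F E c 3) : (quasiSplit F E c 3).Adelic) * y)) (⟨_, hct⟩ : adelicUnipotent F E c 3)]

/-- The diagonal case: **`K_{B,𝔬}(b g, b g) = δ_B(b) · K_{B,𝔬}(g, g)`** for `b ∈ B(𝔸_F)` (`U(3)`).
[cite: Rogawski1990, §2.2 (p. 13)] -/
theorem kernelBorelClass_diag_borel_mul {cl : (quasiSplit F E c 3).arithmeticSubgroup → ι}
    (hc : c * c = 1) (hc1 : c ≠ 1)
    (ν : Measure (adelicUnipotent F E c 3)) [ν.IsHaarMeasure] {𝓕 : Set (adelicUnipotent F E c 3)}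
    (h𝓕 : IsFundamentalDomain (rationalUnipotent F E c 3) 𝓕 ν)
    (hclN : IsUnipotentInvariantOnBorel F E c 3 cl)
    {f : (quasiSplit F E c 3).Adelic → ℂ} (hfc : Continuous f) (hf : HasCompactSupport f)
    (b : borelAdelic F E c 3) (g : (quasiSplit F E c 3).Adelic) (i : ι) :
    kernelBorelClass ν 𝓕 cl i f ((b : (quasiSplit F E c 3).Adelic) * g) ((b : (quasiSplit F E c 3).Adelic) * g) =
      (torusRootModulus E 3 (diagUnit b.2) : ℝ) • kernelBorelClass ν 𝓕 cl i f g g :=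
  kernelBorelClass_borel_mul_mul hc hc1 ν h𝓕 hclN hfc hf b g g i

end Homogeneity

end UnitaryGroup

end Literature.NumberTheory.Automorphic
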